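import Summits.AtomisticToContinuum.Crystallization.Theorems.FrustratedLawDichotomyStrainedPatchHomCurvLeafHC
import Summits.AtomisticToContinuum.Crystallization.Theorems.FrustratedLawDichotomyStrainedPatchHomHertzN

/-!
# G5′ PROTOTYPE (kit arithmetic): the CENTRED SECOND-ORDER VALUE LEAF with an outward-rounded INTERVAL HESSIAN in the joint
# coordinates `(U, ξ)` (27623 `(H) HomFloor`, hcp half; decomp-a2c hand-1 g41 — critic rows 1481 ③ / 1484 (C)(E) / 1497; KITMAP-g41 N1/N3)

The verdicts of record for the E region certify the energy disjunct of the `hver` shape (`…HomEntrySemantic.HcpLeafGoal`, second disjunct)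
by ZERO-ORDER interval evaluation in the entries `U` (table leaf `tableLeafOKHV` on the reference box) and a ξ-expansion (`entryLeafOKHC/HCC`).
At `U`-half-width `2⁻⁷` the zero-order `U`-loss (`≈ ‖∇_U S‖₁ · 2⁻⁷ ≈ 3·10⁻³` surplus) exceeds the margins (hand-1 g40 FINDING §1/§9).  This module is
the KERNEL ARITHMETIC of the joint second-order leaf that (I1) will make a verdict of record (soundness theorem = (I1), next hand-1 generation):

MATHEMATICS (three LINEAR-path expansions; `x = (U, ξ)`, box `B = B_U × Ξ`, centre `x_c = (U_c, ξ_c)`, `δ = x − x_c`; `E(x) = Σ_A W‖U p_b‖ + Σ_B W‖U(p_b + s + ξ)‖`,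
`W = W₄₅` globally `C¹`, piecewise `C²`):
 (i)  `τ ↦ E(U_c, ξ_c + τδξ)`:  `E(U_c, ξ) ≥ E(x_c) + ∇_ξE(x_c)·δξ + ½ δξᵀ H_ξξ δξ − ½ Σ rad_ξξ |δξ||δξ|`, `H_ξξ ∈ [H^c_ξξ ± rad]` over `U_c × Ξ`;
 (ii) `τ ↦ ∇_U E(U_c, ξ_c + τδξ)` (first order): `|∇_U E(U_c, ξ) − ∇_U E(x_c) − H^c_Uξ δξ| ≤ rad_Uξ |δξ|`, `H_Uξ` over `U_c × Ξ`;
 (iii) `s ↦ E(U_c + sδU, ξ)`:  `E(U, ξ) ≥ E(U_c, ξ) + ∇_U E(U_c, ξ)·δU + ½ δUᵀ H_UU δU − ½ Σ rad_UU |δU||δU|`, `H_UU` over the FULL box.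
Sum: `E(x) ≥ V₀ + g·δ + ½ δᵀ H^c δ − Σ_k grad_k^rad |δ_k| − ½ Σ_kl rad_kl |δ_k||δ_l|` with `V₀ ≤ E(x_c)` (table leaf at the POINT box) and `g ∋ ∇E(x_c)`.
FOLDING: `U` is self-adjoint in the `hver` shape and the production boxes have symmetric centres, so `δU` is symmetric: the 12 coordinates fold to
9 (`6` symmetric entry pairs + `3` shuffle) — this removes the rotational zero modes of the unfolded `U`-Hessian (without folding no convexity credit
survives on the off-diagonal entries).  BOX MINIMUM of the quadratic model `q(t) = g·t + ½ tᵀH̃^c t` over `|t_k| ≤ w_k`: an ANCHOR `t⋆` (projected Gauss–Seidel, heuristic) and a shift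
`κ ≥ 0` with `H̃^c + κ·1 ⪰ 0` (exact integer PSD test `…HomHertzN.psdTestN 9`); then `q(t) ≥ q(t⋆) + ∇q(t⋆)·(t − t⋆) − ½κ‖t − t⋆‖²`, minimised
coordinate-wise in closed form (exact integers).  LEAF BOUND (SC units): `LB = V₀ + boxMin − penG − penH`, verdict `μ ≤ LB`.

Per-label Hessian data (`y = U q`, `ρ = ‖y‖`, `β = W′/ρ`, `α = (W″ − W′/ρ)/ρ²` from `…HomCurvDispatch2.coeffFI2`, all regimes hulled):
`∂²/∂U_{ab}∂U_{cd} = (βδ_ac + α y_a y_c) q_b q_d`, `∂²/∂U_{ab}∂ξ_i = q_b (β U_ai + α y_a (Uᵀy)_i) + β y_a δ_bi` (B family), `∂²/∂ξ_i∂ξ_j = β(UᵀU)_ij + α (Uᵀy)_i(Uᵀy)_j`,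
`∂/∂U_{ab} = β y_a q_b`, `∂/∂ξ_i = β (Uᵀy)_i`.  Labels: `nearB/nearA` = the `[−7,7]³` labels whose `ρ²`-enclosure on the FULL box goes below `(9/2)²`
(the others have `W ≡ 0` on the box).  Everything tabulated ONCE per label per box (KITMAP §2 (e)), directly in the FOLDED coordinates
(`H̃_pq = α z_p z_q + β n_pq` with the first-order moments `z_p = Σ_{(a,b)∈p} y_a q_b`: one `α`-product per entry); array storage for the 9 × 9 accumulators.

DEFINITIONS ONLY (computable, outward-rounded `FI` arithmetic of `Literature.Analysis.ValidatedNumerics.FixedPointInterval`); no theorem is claimed here —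
the soundness theorem `valueLeafT2_sound` (hver shape) is (I1).  0 sorry; no instances / notation / `#eval`.  `--supports stmt-AtomisticToContinuum-27623`.
-/

namespace Summit.AtomisticToContinuum.Crystallization.Theorems.FrustratedLawDichotomyStrainedPatchHomValueT2Kit

open Literature.Analysis.ValidatedNumerics.Numerics
open Summit.AtomisticToContinuum.Crystallization.Theorems.FrustratedLawDichotomyStrainedPatchHomEntryGram (entryFI cen rad)
open Summit.AtomisticToContinuum.Crystallization.Theorems.FrustratedLawDichotomyStrainedPatchHomEntryGramHcp (s3 s83 s23 dot3 shufFI)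
open Summit.AtomisticToContinuum.Crystallization.Theorems.FrustratedLawDichotomyStrainedPatchHomForceKit (vecA vecB)
open Summit.AtomisticToContinuum.Crystallization.Theorems.FrustratedLawDichotomyStrainedPatchHomCurvCoeff (coeffFI2 alphaLJFI wFI rhoFI bumpS54FI)
open Summit.AtomisticToContinuum.Crystallization.Theorems.FrustratedLawDichotomyStrainedPatchHomCurvCoeff3 (bumpTFI k75)
open Summit.AtomisticToContinuum.Crystallization.Theorems.FrustratedLawDichotomyStrainedPatchHomForceKit (phiFI)
open Summit.AtomisticToContinuum.Crystallization.Theorems.FrustratedLawDichotomyStrainedPatchHomCurvLeaf (boxLabels7)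
open Summit.AtomisticToContinuum.Crystallization.Theorems.FrustratedLawDichotomyStrainedPatchHomCurvCentreKit (boxE cenE cenX zW)
open Summit.AtomisticToContinuum.Crystallization.Theorems.FrustratedLawDichotomyStrainedPatchHomHertzN (psdTestN)
open Summit.AtomisticToContinuum.Crystallization.Theorems.FrustratedLawDichotomyStrainedPatchHomLeafTableCheckHcpV (tableLeafOKHV)
open Summit.AtomisticToContinuum.Crystallization.Theorems.FrustratedLawDichotomyStrainedPatchHomLeafTableCheck (qTableK1 tabE)

/-! ## §1. Label geometry in the kernel -/

/-- The zero interval. -/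
def fi0 : FI := FI.ofInt 0

/-- Components of the frame vectors `hexFrame i` (`f₀ = (1,0,0)`, `f₁ = (1/2, √3/2, 0)`, `f₂ = (0, 0, √(8/3))`). -/
def frameFI (i a : Fin 3) : FI :=
  if i = 0 then (if a = 0 then FI.ofInt 1 else fi0)
  else if i = 1 then (if a = 0 then FI.ofFrac 1 2 else if a = 1 then s3.divNat 2 else fi0)
  else (if a = 2 then s83 else fi0)

/-- Components of `hcpShift = (1/2, √3/6, √(2/3))`. -/
def shiftFI (a : Fin 3) : FI := if a = 0 then FI.ofFrac 1 2 else if a = 1 then s3.divNat 6 else s23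

/-- Components of the lattice point `p_b = Σᵢ bᵢ fᵢ` (independent of `U`). -/
def pA (b : Fin 3 → ℤ) (a : Fin 3) : FI :=
  (((frameFI 0 a).mulInt (b 0)).add ((frameFI 1 a).mulInt (b 1))).add ((frameFI 2 a).mulInt (b 2))

/-- Components of `q_b = p_b + hcpShift + ξ` over the shuffle box `X` (`B` family argument of `U`). -/
def qB (X : Fin 3 → FI) (b : Fin 3 → ℤ) (a : Fin 3) : FI := ((pA b a).add (shiftFI a)).add (X a)

/-- `y_a = (U q)_a = Σ_b U_ab q_b` over the entry box `E` — ONE product per entry (the split `U p_b + U(s + ξ)` of `…HomForceKit.vecB` doubles the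
`U`-width for labels with `|p_b| + |s| ≫ |p_b + s|`; measured ×2–3 on the nearest neighbours at `2⁻⁷`). -/
def yOf (E : Fin 3 × Fin 3 → FI) (q : Fin 3 → FI) (a : Fin 3) : FI :=
  (((E (a, 0)).mul (q 0)).add ((E (a, 1)).mul (q 1))).add ((E (a, 2)).mul (q 2))

/-- `(Uᵀ y)_i = Σ_a U_ai y_a` over the entry box `E`. -/
def utY (E : Fin 3 × Fin 3 → FI) (Y : Fin 3 → FI) (i : Fin 3) : FI :=
  (((E (0, i)).mul (Y 0)).add ((E (1, i)).mul (Y 1))).add ((E (2, i)).mul (Y 2))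

/-- `(Uᵀ U)_ij = Σ_a U_ai U_aj` over the entry box `E`. -/
def utU (E : Fin 3 × Fin 3 → FI) (i j : Fin 3) : FI :=
  (((E (0, i)).mul (E (0, j))).add ((E (1, i)).mul (E (1, j)))).add ((E (2, i)).mul (E (2, j)))

/-- The squared-radius threshold `(9/2)²` (beyond it `W₄₅ ≡ 0`). -/
def farQ : FI := FI.ofFrac 81 4

/-! ## §1b. TIGHT per-label coefficients: MONOTONE endpoint hulls of `α_LJ(q) = 14q⁻⁸ − 8q⁻⁵` and `β_LJ(q) = q⁻⁴ − q⁻⁷` (`q = ρ²`)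

The closed forms of `…HomCurvCoeff` lose ×1.8–2.4 on the `q`-intervals of a `2⁻⁷` box (measured, hand-1 g41: `α ∈ [3.2, 40]` vs the true range `[11.1, 31.8]`
for the most compressed neighbour) by interval dependency in `14u⁸ − 8u⁵`.  Here: `α_LJ` is decreasing on `q < q_α := (14/5)^{1/3} ≈ 1.4095` and increasing
beyond, convex on `q < (21/5)^{1/3} ≈ 1.613`; `β_LJ` is increasing on `q < q_β := (7/4)^{1/3} ≈ 1.2051`, decreasing beyond, concave on `q < q_α` — so the
hulls are ENDPOINT values (thin-interval evaluations of the landed closed forms) away from the critical points and the naive hull near them.  Bump regime: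
minus the `ω`-corrections `(75/2048)·T(5ρ/4)` / `(3/160)(5/4)S(5ρ/4)` evaluated on the `w`-interval (small); the bump/LJ junction `q ∋ 64/25` is HULLED with the
correction evaluated on the clipped `w ≤ 2`; `q.hi ≥ 9` (window / far / its junctions) falls back to `coeffFI2`. -/

/-- Thin interval at a scaled integer. -/
def thin (k : ℤ) : FI := ⟨k, k⟩

/-- Scaled rational constant `⌊n·SC/d⌋`. -/
def qc (n d : ℕ) : ℤ := (n : ℤ) * (SC : ℤ) / d

/-- Endpoint/naive hull of `α_LJ` on `[Q.lo, Q.hi]` (`none` iff a thin evaluation fails, i.e. `Q.lo ≤ 0`). -/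
def alphaLJHull (Q : FI) : Option FI :=
  match alphaLJFI (thin Q.lo), alphaLJFI (thin Q.hi), alphaLJFI Q with
  | some a1, some a2, some an =>
    let hi := if Q.lo < qc 142 100 ∧ qc 160 100 < Q.hi then an.hi else max a1.hi a2.hi
    let lo := if Q.hi ≤ qc 140 100 then a2.lo else if qc 142 100 ≤ Q.lo then a1.lo else an.lo
    some ⟨lo, hi⟩
  | _, _, _ => none

/-- Endpoint/naive hull of `β_LJ` on `[Q.lo, Q.hi]`. -/
def betaLJHull (Q : FI) : Option FI :=
  match phiFI (thin Q.lo), phiFI (thin Q.hi), phiFI Q with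
  | some b1, some b2, some bn =>
    let lo := if Q.hi ≤ qc 140 100 ∨ qc 122 100 ≤ Q.lo then min b1.lo b2.lo else bn.lo
    let hi := if Q.hi ≤ qc 119 100 then b2.hi else if qc 122 100 ≤ Q.lo then b1.hi else bn.hi
    some ⟨lo, hi⟩
  | _, _, _ => none

/-- `w = 5ρ/4` interval of `Q`, optionally clipped to `w ≤ 2` (bump branch of a junction hull). -/
def wOf (Q : FI) (clip : Bool) : FI :=
  let W := wFI (rhoFI Q)
  if clip then ⟨min W.lo (2 * (SC : ℤ)), min W.hi (2 * (SC : ℤ))⟩ else W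

/-- ★ **TIGHT `(α, β)` of a label** from `Q ∋ ρ²`: bump (`Q.hi < 64/25`), Lennard-Jones (`64/25 < Q.lo`, `Q.hi < 9`), their junction (hull), else `coeffFI2`. -/
def coeffT (Q : FI) : Option (FI × FI) :=
  if 9 * (SC : ℤ) ≤ Q.hi then coeffFI2 Q
  else
    match alphaLJHull Q, betaLJHull Q with
    | some a, some b =>
      if Q.hi < qc 64 25 then
        let W := wOf Q false
        some (a.sub (k75 (bumpTFI W)), b.sub (((bumpS54FI W).mulInt 3).divNat 160))
      else if qc 65 25 ≤ Q.lo then some (a, b)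
      else
        let W := wOf Q true
        some (a.hull (a.sub (k75 (bumpTFI W))), b.hull (b.sub (((bumpS54FI W).mulInt 3).divNat 160)))
    | _, _ => none

/-- Tabulate a `Fin 3`-indexed triple once (avoids re-evaluation through closures). -/
def tab3 (f : Fin 3 → FI) : Fin 3 → FI :=
  let f0 := f 0
  let f1 := f 1
  let f2 := f 2
  fun a => if a = 0 then f0 else if a = 1 then f1 else f2

/-- `B`-family labels whose `ρ²`-enclosure over the box `(c, w)` goes below `(9/2)²`. -/
def nearB (c w : (Fin 3 × Fin 3) ⊕ Fin 3 → ℤ) : List (Fin 3 → ℤ) :=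
  let E := boxE c w
  let X := shufFI c w
  boxLabels7.filter fun b =>
    let y := tab3 (yOf E (tab3 (qB X b)))
    decide ((dot3 y y).lo < farQ.hi)

/-- `A`-family labels (`b ≠ 0`) whose `ρ²`-enclosure over the box `(c, w)` goes below `(9/2)²`. -/
def nearA (c w : (Fin 3 × Fin 3) ⊕ Fin 3 → ℤ) : List (Fin 3 → ℤ) :=
  let E := boxE c w
  boxLabels7.filter fun b =>
    let y := tab3 (yOf E (tab3 (pA b)))
    decide (b 0 ≠ 0 ∨ b 1 ≠ 0 ∨ b 2 ≠ 0) && decide ((dot3 y y).lo < farQ.hi)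

/-! ## §2. FOLDED coordinates (`Fin 9`: `0,1,2` = `U_00,U_11,U_22`; `3 = U_01=U_10`, `4 = U_02=U_20`, `5 = U_12=U_21`; `6,7,8` = `ξ`) and array storage -/

/-- The zero interval array of length `n`. -/
def zeroArr (n : ℕ) : Array FI := Array.replicate n fi0

/-- Entrywise interval sum of two arrays read at the first `n` indices. -/
def addArr (n : ℕ) (A B : Array FI) : Array FI := Array.ofFn fun i : Fin n => (A.getD i.val fi0).add (B.getD i.val fi0)

/-- Read entry `(k, l)` of a row-major `9 × 9` interval array. -/
def get81F (A : Array FI) (k l : ℕ) : FI := A.getD (9 * k + l) fi0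

/-- The entry members `(a, b)` of the folded `U`-coordinate `p < 6` (diagonal: one member; off-diagonal pair: two). -/
def memU (p : ℕ) : List (Fin 3 × Fin 3) :=
  if p = 0 then [(0, 0)] else if p = 1 then [(1, 1)] else if p = 2 then [(2, 2)]
  else if p = 3 then [(0, 1), (1, 0)] else if p = 4 then [(0, 2), (2, 0)] else if p = 5 then [(1, 2), (2, 1)] else []

/-! ## §3. Per-label contributions in folded coordinates (tabulated once per label) -/

/-- Per-label data over a box: `y = Uq` (3), `q` (3), `(α, β)`, `Uᵀy` (3), and the folded first-order `U`-moments `z_p = Σ_{(a,b)∈p} y_a q_b` (6). -/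
structure LRec where
  /-- components of `y = U q` -/
  y : Fin 3 → FI
  /-- components of the argument `q` -/
  q : Fin 3 → FI
  /-- `α = (W″ − W′/ρ)/ρ²` -/
  al : FI
  /-- `β = W′/ρ` -/
  be : FI
  /-- components of `Uᵀ y` -/
  uy : Fin 3 → FI
  /-- folded moments `z_p`, `p < 6` -/
  z : Array FI

/-- Build the record from `q` over the entry box `E` (`none` iff the coefficient dispatcher fails: the `ρ²`-enclosure reaches `0`). -/
def mkRec (E : Fin 3 × Fin 3 → FI) (q : Fin 3 → FI) : Option LRec :=
  let qt := tab3 q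
  let y := tab3 (yOf E qt)
  match coeffT (dot3 y y) with
  | none => none
  | some ab =>
    let uy := tab3 (utY E y)
    let z : Array FI := Array.ofFn fun p : Fin 6 =>
      (memU p.val).foldl (fun s ab' => s.add ((y ab'.1).mul (qt ab'.2))) fi0
    some ⟨y, qt, ab.1, ab.2, uy, z⟩

/-- The record of an `A`-family label. -/
def recA (E : Fin 3 × Fin 3 → FI) (b : Fin 3 → ℤ) : Option LRec := mkRec E (pA b)
/-- The record of a `B`-family label. -/
def recB (E : Fin 3 × Fin 3 → FI) (X : Fin 3 → FI) (b : Fin 3 → ℤ) : Option LRec := mkRec E (qB X b)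

/-- `n_pq = Σ_{(a,b)∈p, (c,d)∈q} [a = c] q_b q_d` (the `β`-pattern of the folded `UU` entry). -/
def nPat (R : LRec) (p q : ℕ) : FI :=
  (memU p).foldl (fun s ab => (memU q).foldl (fun s' cd => if ab.1 = cd.1 then s'.add ((R.q ab.2).mul (R.q cd.2)) else s') s) fi0

/-- `m_{p,i} = Σ_{(a,b)∈p} (q_b U_ai + [b = i] y_a)` (the `β`-pattern of the folded `Uξ` entry) over the entry box `E`. -/
def mPat (E : Fin 3 × Fin 3 → FI) (R : LRec) (p : ℕ) (i : Fin 3) : FI :=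
  (memU p).foldl (fun s ab => (s.add ((R.q ab.2).mul (E (ab.1, i)))).add (if ab.2 = i then R.y ab.1 else fi0)) fi0

/-- ★ The folded `UU` block of one label (`9 × 9` row-major; entries `p, q < 6`): `α z_p z_q + β n_pq`. -/
def arrUU (R : LRec) : Array FI :=
  Array.ofFn fun n : Fin 81 =>
    let p := n.val / 9
    let q := n.val % 9
    if p < 6 ∧ q < 6 then ((R.al.mul ((R.z.getD p fi0).mul (R.z.getD q fi0))).add (R.be.mul (nPat R p q))) else fi0

/-- ★ The folded `Uξ` + `ξU` + `ξξ` blocks of one `B`-family label over the entry box `E` (`G = UᵀU`): `(p, 6+i) ↦ β m_{p,i} + α (Uᵀy)_i z_p`,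
`(6+i, 6+j) ↦ β (UᵀU)_ij + α (Uᵀy)_i (Uᵀy)_j`. -/
def arrX (E : Fin 3 × Fin 3 → FI) (G : Fin 3 → Fin 3 → FI) (R : LRec) : Array FI :=
  let ux : Fin 6 → Fin 3 → FI := fun p i => (R.be.mul (mPat E R p.val i)).add (R.al.mul ((R.uy i).mul (R.z.getD p.val fi0)))
  let UX : Array FI := Array.ofFn fun n : Fin 18 => ux ⟨n.val / 3, by omega⟩ ⟨n.val % 3, by omega⟩
  Array.ofFn fun n : Fin 81 =>
    let p := n.val / 9
    let q := n.val % 9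
    if hp : p < 6 then
      (if hq : 6 ≤ q ∧ q < 9 then UX.getD (3 * p + (q - 6)) fi0 else fi0)
    else if hp2 : p < 9 then
      (if hq : q < 6 then UX.getD (3 * q + (p - 6)) fi0
       else if hq2 : q < 9 then
         let i : Fin 3 := ⟨p - 6, by omega⟩
         let j : Fin 3 := ⟨q - 6, by omega⟩
         (R.be.mul (G i j)).add (R.al.mul ((R.uy i).mul (R.uy j)))
       else fi0)
    else fi0

/-- ★ The folded gradient of one label (length 9): `p ↦ β z_p` (`p < 6`), `6+i ↦ β (Uᵀy)_i` (only when `withX`). -/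
def arrG (withX : Bool) (R : LRec) : Array FI :=
  Array.ofFn fun n : Fin 9 =>
    let k := n.val
    if hk : k < 6 then R.be.mul (R.z.getD k fi0)
    else if withX then (if hk2 : k < 9 then R.be.mul (R.uy ⟨k - 6, by omega⟩) else fi0)
    else fi0

/-! ## §4. Block accumulation over the three boxes -/

/-- Guard flag + accumulated array: `ok = false` iff some label's coefficient dispatcher failed. -/
structure Acc where
  /-- all labels dispatched -/
  ok : Bool
  /-- the accumulated interval array -/
  arr : Array FI

/-- Accumulate `f R` (arrays of length `n`) over the records of the labels `L` (record builder `mk`), starting from `A0`. -/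
def accum (n : ℕ) (L : List (Fin 3 → ℤ)) (mk : (Fin 3 → ℤ) → Option LRec) (f : LRec → Array FI) (A0 : Acc) : Acc :=
  L.foldl (fun A b =>
    match mk b with
    | none => ⟨false, A.arr⟩
    | some R => ⟨A.ok, addArr n A.arr (f R)⟩) A0

/-- ★ **The folded `UU` Hessian block over the FULL box** (both families). -/
def hessUU (c w : (Fin 3 × Fin 3) ⊕ Fin 3 → ℤ) (LA LB : List (Fin 3 → ℤ)) : Acc :=
  let E := boxE c w
  let X := shufFI c w
  accum 81 LB (recB E X) arrUU (accum 81 LA (recA E) arrUU ⟨true, zeroArr 81⟩)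

/-- ★ **The folded `Uξ`, `ξξ` Hessian blocks over `U_c × Ξ`** (`B` family). -/
def hessX (c w : (Fin 3 × Fin 3) ⊕ Fin 3 → ℤ) (LB : List (Fin 3 → ℤ)) : Acc :=
  let E := cenE c
  let X := shufFI c w
  let g00 := utU E 0 0
  let g01 := utU E 0 1
  let g02 := utU E 0 2
  let g11 := utU E 1 1
  let g12 := utU E 1 2
  let g22 := utU E 2 2
  let G : Fin 3 → Fin 3 → FI := fun i j =>
    if i = 0 then (if j = 0 then g00 else if j = 1 then g01 else g02)
    else if i = 1 then (if j = 0 then g01 else if j = 1 then g11 else g12)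
    else (if j = 0 then g02 else if j = 1 then g12 else g22)
  accum 81 LB (recB E X) (arrX E G) ⟨true, zeroArr 81⟩

/-- ★ **The folded gradient at the POINT `(U_c, ξ_c)`** (both families). -/
def gradP (c : (Fin 3 × Fin 3) ⊕ Fin 3 → ℤ) (LA LB : List (Fin 3 → ℤ)) : Acc :=
  let E := cenE c
  let X := cenX c
  accum 9 LB (recB E X) (arrG true) (accum 9 LA (recA E) (arrG false) ⟨true, zeroArr 9⟩)

/-! ## §5. Half-widths, centre/radius split -/

/-- Folded half-width: the minimum of the member half-widths (`|t_p| ≤ w_k` for every member `k`). -/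
def foldW (w : (Fin 3 × Fin 3) ⊕ Fin 3 → ℤ) (p : Fin 9) : ℤ :=
  if p.val = 0 then w (Sum.inl (0, 0)) else if p.val = 1 then w (Sum.inl (1, 1)) else if p.val = 2 then w (Sum.inl (2, 2))
  else if p.val = 3 then min (w (Sum.inl (0, 1))) (w (Sum.inl (1, 0)))
  else if p.val = 4 then min (w (Sum.inl (0, 2))) (w (Sum.inl (2, 0)))
  else if p.val = 5 then min (w (Sum.inl (1, 2))) (w (Sum.inl (2, 1)))
  else if p.val = 6 then w (Sum.inr 0) else if p.val = 7 then w (Sum.inr 1) else w (Sum.inr 2)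

/-- The assembled leaf data (all integers in `SC` units): folded Hessian centre `Hc` and radius `Hr` (9 × 9 arrays, row-major 81), gradient centre/radius,
folded half-widths. -/
structure T2Data where
  /-- dispatcher guard -/
  ok : Bool
  /-- folded Hessian centres -/
  Hc : Array ℤ
  /-- folded Hessian radii -/
  Hr : Array ℤ
  /-- folded gradient centres -/
  gc : Array ℤ
  /-- folded gradient radii -/
  gr : Array ℤ
  /-- folded half-widths -/
  wf : Array ℤ

/-- ★ **Assemble the leaf data of the box `(c, w)`**: near-label lists on the full box, the three block accumulations, centre/radius split. -/
def t2Data (c w : (Fin 3 × Fin 3) ⊕ Fin 3 → ℤ) : T2Data :=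
  let LA := nearA c w
  let LB := nearB c w
  let AU := hessUU c w LA LB
  let AX := hessX c w LB
  let AG := gradP c LA LB
  let H := addArr 81 AU.arr AX.arr
  ⟨AU.ok && AX.ok && AG.ok, H.map cen, H.map rad, AG.arr.map cen, AG.arr.map rad, Array.ofFn fun p : Fin 9 => foldW w p⟩

/-! ## §6. The box minimum of the quadratic model: anchor `t⋆` (projected Gauss–Seidel, heuristic), diagonal shift `D = −κ·1` certified by
`psdTestN 9 (H̃^c − D)`, exact expansion `q(t) = q(t⋆) + a·(t − t⋆) + ½ (t − t⋆)ᵀ H̃^c (t − t⋆)` and closed-form coordinate minima -/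

/-- Read entry `(k, l)` of a row-major `9 × 9` integer array. -/
def get81 (A : Array ℤ) (k l : ℕ) : ℤ := A.getD (9 * k + l) 0

/-- Clip to `[−w, w]`. -/
def clipW (x w : ℤ) : ℤ := max (-w) (min w x)

/-- One projected Gauss–Seidel sweep for `q(t) = g·t + ½ tᵀH t` on the box (all `SC`-scaled integers; heuristic anchor, rounding immaterial). -/
def pgsSweep (Hc gc wf : Array ℤ) (t : Array ℤ) : Array ℤ :=
  (List.range 9).foldl (fun t k =>
    let hkk := get81 Hc k k
    let off : ℤ := (List.range 9).foldl (fun s l => if l = k then s else s + get81 Hc k l * t.getD l 0) 0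
    let num : ℤ := (SC : ℤ) * gc.getD k 0 + off
    let w := wf.getD k 0
    let tk : ℤ := if 0 < hkk then clipW (-(num / hkk)) w else (if 0 < num then -w else w)
    t.set! k tk) t

/-- The anchor `t⋆` after `n` sweeps from `0`. -/
def anchor (Hc gc wf : Array ℤ) (n : ℕ) : Array ℤ := (List.range n).foldl (fun t _ => pgsSweep Hc gc wf t) (Array.replicate 9 0)

/-- `(H t)_k` (integer, units `SC²`). -/
def hMul (Hc : Array ℤ) (t : Array ℤ) (k : ℕ) : ℤ := (List.range 9).foldl (fun s l => s + get81 Hc k l * t.getD l 0) 0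

/-- `Hc + κ·1` as a function-presented `9 × 9` integer matrix. -/
def shiftedK (Hc : Array ℤ) (κ : ℤ) : Fin 9 → Fin 9 → ℤ := fun k l => get81 Hc k.val l.val + (if k = l then κ else 0)

/-- Smallest menu shift `κ ≥ 0` (units `SC`; menu `0`, then `2^j · SC/1024`, `j = 0 … 16`) with `Hc + κ·1` passing the exact PSD test; `none` if none passes. -/
def kappaShift (Hc : Array ℤ) : Option ℤ :=
  if psdTestN 9 (shiftedK Hc 0) then some 0
  else ((List.range 17).map fun j => (2 : ℤ) ^ j * ((SC : ℤ) / 1024)).find? fun κ => psdTestN 9 (shiftedK Hc κ)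

/-- ★ Exact lower bound of `min_{s ∈ [lo, hi]} (2 A s + D s²)` over the REALS (`lo ≤ hi` integers): interior vertex `−⌈A²/D⌉` when `D > 0` and
`lo·D ≤ −A ≤ hi·D`, else the smaller end-point value. -/
def segMin (A D lo hi : ℤ) : ℤ :=
  if 0 < D ∧ lo * D ≤ -A ∧ -A ≤ hi * D then -cdiv (A * A) D
  else min (2 * A * lo + D * lo * lo) (2 * A * hi + D * hi * hi)

/-- ★★ **THE CERTIFIED BOX MINIMUM of the quadratic model** `g·t + ½ tᵀ H̃^c t` over `|t_k| ≤ w_k` (in `SC` units, rounded down), given a PSD-certified shift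
`κ` (`H̃^c + κ·1 ⪰ 0`): `q(t⋆) + Σ_k min_s [a_k s − ½ κ s²]`, `a = ∇q(t⋆)`, `s ∈ [−w_k − t⋆_k, w_k − t⋆_k]`.  (Soundness, for (I1): `q(t) − q(t⋆) − a·(t−t⋆) =
½(t−t⋆)ᵀH̃^c(t−t⋆) ≥ −½κ‖t−t⋆‖²` by `qfN_nonneg_of_psdTestN`.) -/
def boxMin (Hc gc wf : Array ℤ) (κ : ℤ) (t : Array ℤ) : ℤ :=
  -- 2·SC²·q(t⋆) = 2·SC·g·t⋆ + t⋆ᵀ H t⋆  (exact integer)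
  let q2 : ℤ := (List.range 9).foldl (fun s k => s + 2 * (SC : ℤ) * gc.getD k 0 * t.getD k 0 + t.getD k 0 * hMul Hc t k) 0
  -- A_k = SC·g_k + (H t⋆)_k  (so a_k = A_k/SC² real);  Σ_k min_s (2 A_k s + (−κ) s²)
  let m2 : ℤ := (List.range 9).foldl (fun s k =>
    let A := (SC : ℤ) * gc.getD k 0 + hMul Hc t k
    let w := wf.getD k 0
    let tk := t.getD k 0
    s + segMin A (-κ) (-w - tk) (w - tk)) 0
  (q2 + m2) / (2 * (SC : ℤ) * (SC : ℤ))

/-- The Hessian-radius penalty `½ Σ_kl Hr_kl w_k w_l` in `SC` units (rounded up). -/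
def penH (T : T2Data) : ℤ :=
  cdiv ((List.range 9).foldl (fun s k => (List.range 9).foldl (fun s' l => s' + get81 T.Hr k l * T.wf.getD k 0 * T.wf.getD l 0) s) 0)
    (2 * (SC : ℤ) * (SC : ℤ))

/-- The gradient-radius penalty `Σ_k gr_k w_k` in `SC` units (rounded up). -/
def penG (T : T2Data) : ℤ := cdiv ((List.range 9).foldl (fun s k => s + T.gr.getD k 0 * T.wf.getD k 0) 0) (SC : ℤ)

/-- Symmetry of the folded centre matrix (required by the PSD certificate). -/
def symOK (Hc : Array ℤ) : Bool := decide (∀ k l : Fin 9, get81 Hc k.val l.val = get81 Hc l.val k.val)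

/-! ## §7. The value at the centre point and the verdict -/

/-- Largest passing target of a monotone Boolean by bisection (`f a = true` assumed; returns `a` refined `n` times towards `b`). -/
def bisectUp (f : ℤ → Bool) : ℤ → ℤ → ℕ → ℤ
  | a, _, 0 => a
  | a, b, n + 1 => let mid := (a + b) / 2; if f mid then bisectUp f mid b n else bisectUp f a mid n

/-- ★ **Value floor at the centre POINT** `V₀ ≤ E(U_c, ξ_c)·SC` from the vector-form table leaf of record on the zero-width box, by bisection in
`[μ − 2⁴⁴, μ + 2⁴⁴]` (30 steps); `none` if even `μ − 2⁴⁴` fails. -/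
def valueP (μ : ℤ) (c : (Fin 3 × Fin 3) ⊕ Fin 3 → ℤ) : Option ℤ :=
  let f : ℤ → Bool := fun m => tableLeafOKHV qTableK1 tabE m c zW
  let lo := μ - 17592186044416
  if f lo then some (bisectUp f lo (μ + 17592186044416) 30) else none

/-- The symmetric-centre guard (folding presupposes `c_ab = c_ba`) and positive folded widths. -/
def foldGuard (c w : (Fin 3 × Fin 3) ⊕ Fin 3 → ℤ) : Bool :=
  decide (c (Sum.inl (0, 1)) = c (Sum.inl (1, 0)) ∧ c (Sum.inl (0, 2)) = c (Sum.inl (2, 0)) ∧ c (Sum.inl (1, 2)) = c (Sum.inl (2, 1))) &&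
    decide (∀ p : Fin 9, 0 < foldW w p)

/-- ★★ **The leaf report** `(flag, V₀ − μ, boxMin, penG, penH, κ, LB − μ)` in `SC` units (`/2SC` = surplus units); `flag = guard ∧ dispatch ∧ symmetric ∧
value found ∧ shift found`; failing pieces are reported as `0` with the flag off. -/
def t2Report (μ : ℤ) (c w : (Fin 3 × Fin 3) ⊕ Fin 3 → ℤ) : Bool × ℤ × ℤ × ℤ × ℤ × ℤ × ℤ :=
  let T := t2Data c w
  match valueP μ c, kappaShift T.Hc with
  | some v, some κ =>
    let t := anchor T.Hc T.gc T.wf 40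
    let bm := boxMin T.Hc T.gc T.wf κ t
    let pg := penG T
    let ph := penH T
    (foldGuard c w && T.ok && symOK T.Hc, v - μ, bm, pg, ph, κ, v + bm - pg - ph - μ)
  | some v, none => (false, v - μ, 0, 0, 0, -1, 0)
  | none, _ => (false, 0, 0, 0, 0, 0, 0)

/-- ★★★ **THE G5′ PROTOTYPE VERDICT** `valueLeafT2 μ c w`: flag ∧ `μ ≤ V₀ + boxMin − penG − penH`. -/
def valueLeafT2 (μ : ℤ) (c w : (Fin 3 × Fin 3) ⊕ Fin 3 → ℤ) : Bool :=
  let r := t2Report μ c w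
  r.1 && decide (0 ≤ r.2.2.2.2.2.2)

end Summit.AtomisticToContinuum.Crystallization.Theorems.FrustratedLawDichotomyStrainedPatchHomValueT2Kit
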